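import Summits.BirchSwinnertonDyer.BirchSwinnertonDyer.Theorems.ErratumRoadFiveNonSurjCornerLocalCharacter
import Summits.BirchSwinnertonDyer.Rank1Residual.X11b.MultiplicativeSurjectivity
import Literature.NumberTheory.EllipticCurves.Rank1Residual.X9NoEntry
import Literature.NumberTheory.EllipticCurves.PastenValuationProductTamagawaProofs
import Literature.NumberTheory.EllipticCurves.LocalTorsionMultiplicativeProofs
import HarnessLib

/-!
# Route `ErratumRoadFive` (rung K2), crux `NonSurjCorner` (item stmt-BirchSwinnertonDyer-19065):
# THE TAMAGAWA EXPONENT `t = ord_p ∏_v c_v` OF A CORNER PAIR — `t` counts the SPLIT multiplicative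
# places, each with weight `ord_p ord_v(Δ_min) ≥ 1`; `t = 0` iff `E` has NO split multiplicative
# place; on the `t = 0` sub-corner `E(ℚ_p)[p] = 0`
# (cell `bsd-stepL`, seat `bsd-stepL-corner5-p2` g4, WIDTH-LEVER lane B «class-level road»;
# `--supports stmt-BirchSwinnertonDyer-19065 --as helper`)

WHY THIS FILE. Both Kolyvagin children of the crux are indexed by the single corner invariant
`t = padicValNat p W.tamagawaProduct = ord_p ∏_v c_v(E/ℚ)`: the certificate branch Zₚᶜ
(`Theorems.NonSurjCornerKolyZ`: «some level `M ≤ t` carries a certificate») and the Jetchev branch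
Jₚᶜ (`Theorems.NonSurjCornerKolyJ`: «`P_n ∈ p^s E(K[n])` for every `s ≤ t`»); lane A's case analysis
of `stub_kolyJ_max` splits along `t = 0` (`…KolyJTamZero`, `…TwinLeafSub`: `¬ p ∣ W.tamagawaProduct`)
versus `t ≥ 1`. This file computes `t` on the corner from the reduction types alone.

§1 (any elliptic `W/ℚ`, any prime `p ≥ 5`; Kodaira–Néron, tree theorems
`localTamagawaNumber_eq_ordMinimalDiscriminant_of_hasSplitMultiplicativeReductionAt` (split:
`c_v = ord_v Δ_min`) and `index_goodReductionSubgroup_le_four_holds` (otherwise `1 ≤ c_v ≤ 4`)):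
* `padicValNat_tamagawaProduct_eq_sum`: **`ord_p Tam(E) = Σ_{v split multiplicative} ord_p ord_v(Δ_min)`**
  (as a sum over any finite set of places containing the bad ones);
* `dvd_tamagawaProduct_iff_exists_split` : `p ∣ Tam(E) ⟺` some split multiplicative `v` has
  `p ∣ ord_v(Δ_min)`; `dvd_tamagawaProduct_of_split_of_dvd` and
  `padicValNat_ordMinimalDiscriminant_le_padicValNat_tamagawaProduct` (any prime).

§2 (the corner: `ClassX11b W p`, `ρ̄_{E,p}` not onto; `W` globally minimal):
* `NonSurjCorner.dvd_ordMinimalDiscriminant_of_hasMultiplicativeReductionAt`: **`p ∣ ord_v(Δ_min)` at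
  EVERY multiplicative place `v`** — at `v ∣ p` this is the idle binder (`…Binders`, x11c gen 8:
  `E[p]` peu ramifié), at `v ∤ p` it is `¬ Ram` (`E[p]` unramified at `ℓ`); one uniform statement.
* `NonSurjCorner.dvd_tamagawaProduct_of_split`: **every split multiplicative place forces `p ∣ Tam(E)`**
  (`t ≥ 1`), at `p` or away from `p`, for any prime `p`;
* `NonSurjCorner.dvd_tamagawaProduct_iff_exists_split` / `…not_dvd_tamagawaProduct_iff_forall_not_split`
  (`p ≥ 5`): **`t ≥ 1 ⟺ E has a split multiplicative place; t = 0 ⟺ every multiplicative place of E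
  is non-split`**; `NonSurjCorner.card_filter_split_le_padicValNat_tamagawaProduct`: `t ≥ #{split places}`.
* `NonSurjCorner.not_split_of_not_dvd_tamagawaProduct` (+ the `…AtPrime p` form) and
  `NonSurjCorner.forall_fixed_eq_zero_of_not_dvd_tamagawaProduct`: **on the `t = 0` sub-corner `E` is
  NON-SPLIT at `p` and `E(ℚ_p)[p] = 0`** (∘ this seat's `NonSurjCorner.forall_fixed_eq_zero_of_not_split`,
  file `…LocalCharacter`, p552392).
Census check (lane A CORNER-G3 §1, 64 pairs at `p = 5`): `t = 0` on exactly the 24 pairs all of whose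
multiplicative primes are non-split (e.g. 3240a1, 21660j1 `3: ns`, 52345a1 `29: ns`); `t ≥ 1` on the
35 pairs split at `5` and on the 5 non-split-at-`5` pairs with a split `ℓ ≠ 5` (21660u1 `3: s`, 59040bf1
∕ bg1 `41: s`, 84960z1 ∕ 169920dc1 `59: s`); `t = 2` = two split places (84960d1, 296240ce1, 304560by1).

HONEST FRAMING: structure theorems (0 definitions, 0 named facts, 0 sorry); nothing here proves the
crux, a registered stub (`stub_corner5`, `stub_corner7`) or BSD for any class; no census number moves
(T7). References: [SilvermanATAEC1994] Cor. IV.9.2 (d), Table 4.1 (Kodaira–Néron ∕ Tate's algorithm);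
[SilvermanAEC2009] VII.6.1, C.16; [Jetchev2008] §1 (`t = ord_p ∏ c_q`); [GrossLMS1991] §1 (BSD over `K`
and the Tamagawa factors); tree `PastenValuationProductTamagawaProofs` (`Tam ≤ ∏ max(4, v_p Δ)`, same
local analysis), `Theorems/ErratumRoadFiveNonSurjCorner{Binders,LocalCharacter}`.
-/

set_option linter.dupNamespace false -- `Summit.BirchSwinnertonDyer.BirchSwinnertonDyer` (summit = problem), tree-wide
set_option autoImplicit false

noncomputable section

open scoped Classical NumberField
open IsDedekindDomain Field WeierstrassCurve

namespace Summit.BirchSwinnertonDyer.BirchSwinnertonDyer.Theorems.CornerLocal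

open WeierstrassCurve NumberField Rat.HeightOneSpectrum
  Literature.NumberTheory.EllipticCurves
  Literature.NumberTheory.EllipticCurves.Rank1Residual
  Summit.BirchSwinnertonDyer.Rank1Residual

variable (W : WeierstrassCurve ℚ) [W.IsElliptic] (p : ℕ) [hp : Fact p.Prime]

/-! ### §1. `ord_p` of the Tamagawa product of any elliptic curve over `ℚ`, `p ≥ 5` -/

/-- `c_v ≥ 1` at every finite place (a finite index; Silverman *AEC* Cor. VII.6.2, the tree's
`localTamagawaNumber_baseChange_ne_zero`). [cite: SilvermanAEC2009, Cor. VII.6.2] -/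
theorem one_le_localTamagawaNumber (v : HeightOneSpectrum (𝓞 ℚ)) :
    1 ≤ (W.baseChange (v.adicCompletion ℚ)).localTamagawaNumber (v.adicCompletionIntegers ℚ) :=
  Nat.one_le_iff_ne_zero.mpr (W.localTamagawaNumber_baseChange_ne_zero v)

/-- **Kodaira–Néron, the bound `4`**: at a place which is NOT split multiplicative, `c_v ≤ 4`
(Silverman *ATAEC* Cor. IV.9.2 (d); the tree's discharged `index_goodReductionSubgroup_le_four_holds`
on the local minimal model). [cite: SilvermanATAEC1994, Cor. IV.9.2 (d) (PDF p. 340)] -/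
theorem localTamagawaNumber_le_four_of_not_split (v : HeightOneSpectrum (𝓞 ℚ))
    (hns : ¬ W.HasSplitMultiplicativeReductionAt v) :
    (W.baseChange (v.adicCompletion ℚ)).localTamagawaNumber (v.adicCompletionIntegers ℚ) ≤ 4 := by
  haveI := W.isElliptic_localMinimalModel v
  change ((W.localMinimalModel v).goodReductionSubgroup (v.adicCompletionIntegers ℚ)).index ≤ _
  exact ((W.localMinimalModel v).index_goodReductionSubgroup_le_four_holds
    (v.adicCompletionIntegers ℚ) hns).2

omit hp in
/-- For `p ≥ 5`, a place which is not split multiplicative contributes nothing to `ord_p Tam(E)`: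
`1 ≤ c_v ≤ 4 < p`. [cite: SilvermanATAEC1994, Cor. IV.9.2 (d)] -/
theorem padicValNat_localTamagawaNumber_eq_zero_of_not_split (hp5 : 5 ≤ p)
    (v : HeightOneSpectrum (𝓞 ℚ)) (hns : ¬ W.HasSplitMultiplicativeReductionAt v) :
    padicValNat p ((W.baseChange (v.adicCompletion ℚ)).localTamagawaNumber
      (v.adicCompletionIntegers ℚ)) = 0 := by
  apply padicValNat.eq_zero_of_not_dvd
  intro h
  have h1 := one_le_localTamagawaNumber W v
  have h4 := localTamagawaNumber_le_four_of_not_split W v hns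
  have := Nat.le_of_dvd (by omega) h
  omega

/-- **Kodaira–Néron, split multiplicative case**: `c_v = ord_v(Δ_min)` (Silverman *ATAEC*
Cor. IV.9.2 (d), type `Iₙ`; the tree's
`localTamagawaNumber_eq_ordMinimalDiscriminant_of_hasSplitMultiplicativeReductionAt`), recorded at a
place of `𝓞 ℚ`. [cite: SilvermanATAEC1994, Cor. IV.9.2 (d) (PDF p. 340)] -/
theorem localTamagawaNumber_eq_ordMinimalDiscriminant_of_split (v : HeightOneSpectrum (𝓞 ℚ))
    (hs : W.HasSplitMultiplicativeReductionAt v) :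
    (W.baseChange (v.adicCompletion ℚ)).localTamagawaNumber (v.adicCompletionIntegers ℚ) =
      W.ordMinimalDiscriminant v :=
  localTamagawaNumber_eq_ordMinimalDiscriminant_of_hasSplitMultiplicativeReductionAt v W hs

omit hp in
/-- `Tam(E) = ∏_{v ∈ S} c_v` for every finite set `S` of places containing the bad ones (those with
`ord_v Δ_min ≠ 0`): `c_v = 1` at good places (the tree's
`localTamagawaNumber_eq_one_of_ordMinimalDiscriminant_eq_zero`). [cite: SilvermanAEC2009, C.16 (Tamagawa numbers)] -/
theorem tamagawaProduct_eq_prod (S : Finset (HeightOneSpectrum (𝓞 ℚ)))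
    (hS : ∀ v, W.ordMinimalDiscriminant v ≠ 0 → v ∈ S) :
    W.tamagawaProduct = ∏ v ∈ S,
      (W.baseChange (v.adicCompletion ℚ)).localTamagawaNumber (v.adicCompletionIntegers ℚ) := by
  apply finprod_eq_prod_of_mulSupport_subset
  intro v hv
  rw [Finset.mem_coe]
  exact hS v fun h0 => hv (localTamagawaNumber_eq_one_of_ordMinimalDiscriminant_eq_zero W v h0)

omit hp in
/-- The set of bad places (those with `ord_v Δ_min ≠ 0`) as a `Finset` (the tree's discharged
`finite_setOf_ordMinimalDiscriminant_ne_zero_holds`). [cite: SilvermanAEC2009, VIII.1 Remark 1.3] -/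
theorem exists_finset_bad :
    ∃ S : Finset (HeightOneSpectrum (𝓞 ℚ)), ∀ v, W.ordMinimalDiscriminant v ≠ 0 ↔ v ∈ S :=
  ⟨(W.finite_setOf_ordMinimalDiscriminant_ne_zero_holds (A := 𝓞 ℚ)).toFinset,
    fun v => by rw [Set.Finite.mem_toFinset, Set.mem_setOf_eq]⟩

/-- **`ord_p Tam(E) = Σ_{v split multiplicative} ord_p ord_v(Δ_min)` for `p ≥ 5`** (sum over any
finite set `S` of places containing the bad ones): Kodaira–Néron place by place — `c_v = ord_v Δ_min`
at a split multiplicative place, `1 ≤ c_v ≤ 4 < p` elsewhere. This is the local analysis «`Tam_p(E) ≤ 4`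
unless split multiplicative, where `Tam_p(E) = v_p(Δ_E)`» of the tree's
`tamagawaProduct_le_prod_primeFactors`, read for the `p`-adic valuation.
[cite: SilvermanATAEC1994, Cor. IV.9.2 (d) and Table 4.1] [cite: Jetchev2008, §1 (the exponent ord_p ∏ c_q)] -/
theorem padicValNat_tamagawaProduct_eq_sum (hp5 : 5 ≤ p) (S : Finset (HeightOneSpectrum (𝓞 ℚ)))
    (hS : ∀ v, W.ordMinimalDiscriminant v ≠ 0 → v ∈ S) :
    padicValNat p W.tamagawaProduct =
      ∑ v ∈ S, if W.HasSplitMultiplicativeReductionAt v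
        then padicValNat p (W.ordMinimalDiscriminant v) else 0 := by
  -- `ord_p` of a product of non-zero naturals is the sum of the `ord_p`
  have hprod : ∀ (T : Finset (HeightOneSpectrum (𝓞 ℚ))) (f : HeightOneSpectrum (𝓞 ℚ) → ℕ),
      (∀ v ∈ T, f v ≠ 0) → padicValNat p (∏ v ∈ T, f v) = ∑ v ∈ T, padicValNat p (f v) := by
    intro T f hf
    induction T using Finset.cons_induction with
    | empty => simp
    | cons a s ha ih =>
      rw [Finset.prod_cons, Finset.sum_cons, padicValNat.mul (hf a (Finset.mem_cons_self a s))
        (Finset.prod_ne_zero_iff.mpr fun i hi => hf i (Finset.mem_cons_of_mem hi)),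
        ih fun i hi => hf i (Finset.mem_cons_of_mem hi)]
  rw [tamagawaProduct_eq_prod W S hS, hprod S _ fun v _ => W.localTamagawaNumber_baseChange_ne_zero v]
  refine Finset.sum_congr rfl fun v _ => ?_
  split_ifs with hs
  · rw [localTamagawaNumber_eq_ordMinimalDiscriminant_of_split W v hs]
  · exact padicValNat_localTamagawaNumber_eq_zero_of_not_split W p hp5 v hs

omit hp in
/-- **At a split multiplicative place `ord_v(Δ_min) ∣ Tam(E)`**: `c_v = ord_v Δ_min` (Kodaira–Néron) is
one factor of the finite product `Tam(E) = ∏_w c_w`. (The factor form `c_v ∣ Tam(E)` is the tree's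
`InertBadOdd.localTamagawaNumber_dvd_tamagawaProduct`; restated here on `ord_v Δ_min` to stay import-light.)
[cite: SilvermanATAEC1994, Cor. IV.9.2 (d)] [cite: SilvermanAEC2009, C.16 (Tamagawa numbers)] -/
theorem ordMinimalDiscriminant_dvd_tamagawaProduct_of_split {v : HeightOneSpectrum (𝓞 ℚ)}
    (hs : W.HasSplitMultiplicativeReductionAt v) : W.ordMinimalDiscriminant v ∣ W.tamagawaProduct := by
  obtain ⟨S, hS⟩ := exists_finset_bad W
  rw [← localTamagawaNumber_eq_ordMinimalDiscriminant_of_split W v hs,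
    tamagawaProduct_eq_prod W (insert v S) fun w hw => Finset.mem_insert_of_mem ((hS w).mp hw)]
  exact Finset.dvd_prod_of_mem _ (Finset.mem_insert_self v S)

omit hp in
/-- A split multiplicative place `v` with `p ∣ ord_v(Δ_min)` forces `p ∣ Tam(E)` (any `p`: `c_v =
ord_v Δ_min` divides the Tamagawa product). [cite: SilvermanATAEC1994, Cor. IV.9.2 (d)] -/
theorem dvd_tamagawaProduct_of_split_of_dvd {v : HeightOneSpectrum (𝓞 ℚ)}
    (hs : W.HasSplitMultiplicativeReductionAt v) (hd : p ∣ W.ordMinimalDiscriminant v) :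
    p ∣ W.tamagawaProduct :=
  hd.trans (ordMinimalDiscriminant_dvd_tamagawaProduct_of_split W hs)

/-- At a split multiplicative place, `ord_p ord_v(Δ_min) ≤ ord_p Tam(E)` (any prime `p`).
[cite: SilvermanATAEC1994, Cor. IV.9.2 (d)] -/
theorem padicValNat_ordMinimalDiscriminant_le_padicValNat_tamagawaProduct
    {v : HeightOneSpectrum (𝓞 ℚ)} (hs : W.HasSplitMultiplicativeReductionAt v) :
    padicValNat p (W.ordMinimalDiscriminant v) ≤ padicValNat p W.tamagawaProduct := by
  have h0 : W.tamagawaProduct ≠ 0 := (W.tamagawaProduct_pos_holds).ne'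
  rw [← padicValNat_dvd_iff_le h0]
  exact pow_padicValNat_dvd.trans (ordMinimalDiscriminant_dvd_tamagawaProduct_of_split W hs)

/-- **`p ∣ Tam(E) ⟺ some split multiplicative place has p ∣ ord_v(Δ_min)`, for `p ≥ 5`.**
[cite: SilvermanATAEC1994, Cor. IV.9.2 (d) and Table 4.1] -/
theorem dvd_tamagawaProduct_iff_exists_split (hp5 : 5 ≤ p) :
    p ∣ W.tamagawaProduct ↔
      ∃ v : HeightOneSpectrum (𝓞 ℚ), W.HasSplitMultiplicativeReductionAt v ∧
        p ∣ W.ordMinimalDiscriminant v := by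
  refine ⟨fun hd => ?_, fun ⟨v, hs, hdv⟩ => dvd_tamagawaProduct_of_split_of_dvd W p hs hdv⟩
  obtain ⟨S, hS⟩ := exists_finset_bad W
  by_contra hne
  push Not at hne
  have hsum : padicValNat p W.tamagawaProduct = 0 := by
    rw [padicValNat_tamagawaProduct_eq_sum W p hp5 S fun v hv => (hS v).mp hv]
    refine Finset.sum_eq_zero fun v _ => ?_
    split_ifs with hs
    · exact padicValNat.eq_zero_of_not_dvd (hne v hs)
    · rfl
  have h0 : W.tamagawaProduct ≠ 0 := (W.tamagawaProduct_pos_holds).ne'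
  have h1 : 1 ≤ padicValNat p W.tamagawaProduct := by
    rw [← padicValNat_dvd_iff_le h0, pow_one]; exact hd
  omega

/-- **`p ∤ Tam(E) ⟺ no split multiplicative place has p ∣ ord_v(Δ_min)`, for `p ≥ 5`** (the
negation of the previous statement, in the currency `¬ p ∣ W.tamagawaProduct` of the corner files
`…KolyJTamZero` ∕ `…TwinLeafSub`). [cite: SilvermanATAEC1994, Cor. IV.9.2 (d) and Table 4.1] -/
theorem not_dvd_tamagawaProduct_iff_forall (hp5 : 5 ≤ p) :
    ¬ p ∣ W.tamagawaProduct ↔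
      ∀ v : HeightOneSpectrum (𝓞 ℚ), W.HasSplitMultiplicativeReductionAt v →
        ¬ p ∣ W.ordMinimalDiscriminant v := by
  rw [dvd_tamagawaProduct_iff_exists_split W p hp5]
  push Not
  rfl

/-! ### §2. The corner: `p ∣ ord_v(Δ_min)` at every multiplicative place, so `t` counts split places -/

section Corner

variable [W.IsGloballyMinimal]

/-- `ord_v(Δ_min) = ord_ℓ(Δ_min(W))` at the place `v ↔ ℓ` of `𝓞 ℚ` for a globally minimal `W` (the
tree's `LocalTorsionMult.ordMinimalDiscriminant_eq_padicValInt`, with the prime read off `v`).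
[cite: SilvermanAEC2009, VIII.8 (global minimal equations)] -/
theorem ordMinimalDiscriminant_eq_padicValInt_primesEquiv (v : HeightOneSpectrum (𝓞 ℚ)) :
    W.ordMinimalDiscriminant v = padicValInt (primesEquiv v : ℕ) W.minimalDiscriminantInt := by
  haveI : Fact (primesEquiv v : ℕ).Prime := ⟨(primesEquiv v).2⟩
  exact LocalTorsionMult.ordMinimalDiscriminant_eq_padicValInt W v rfl

/-- **On the corner `p ∣ ord_v(Δ_min)` at EVERY multiplicative place `v`.** For `(E, p)` in class X11b
(`r_an = 1`, `p` odd multiplicative, `E[p]` irreducible) with `ρ̄_{E,p}` NOT onto: at the place of `p`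
this is the idle binder `p ∣ ord_p Δ_min` (x11c gen 8's `GaloisImage.surj_of_mult_of_irr_of_not_dvd`, read
contrapositively: `E[p]` is peu ramifié at `p`, else a transvection makes `ρ̄` onto; cf. this seat's
`NonSurjCorner.dvd_padicValInt_minimalDiscriminantInt`, file `…Binders`), and at a multiplicative `ℓ ≠ p`
it is `¬ Ram` (`Rank1Residual.not_ram_of_irr_of_not_surj`: `E[p]` is unramified at `ℓ`, the image having
order prime to `p`).
[cite: Serre1972, §2.4 Prop. 15, §5.4] [cite: SilvermanATAEC1994, V.6 Prop. 6.1] -/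
theorem NonSurjCorner.dvd_ordMinimalDiscriminant_of_hasMultiplicativeReductionAt (hX : ClassX11b W p)
    (hns : ¬ Surj W p) {v : HeightOneSpectrum (𝓞 ℚ)} (hm : W.HasMultiplicativeReductionAt v) :
    p ∣ W.ordMinimalDiscriminant v := by
  rw [ordMinimalDiscriminant_eq_padicValInt_primesEquiv W v]
  by_cases hv : (primesEquiv v : ℕ) = p
  · -- at `v ∣ p`: peu ramifié, else a transvection makes `ρ̄` onto (x11c gen 8)
    rw [hv]
    by_contra hnd
    exact hns (GaloisImage.surj_of_mult_of_irr_of_not_dvd W p hX.2.1 hX.2.2.1 hX.2.2.2 hnd)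
  · -- at `v ∤ p`: no (ram) witness at an irreducible non-surjective image
    by_contra hnd
    haveI : Fact (primesEquiv v : ℕ).Prime := ⟨(primesEquiv v).2⟩
    exact not_ram_of_irr_of_not_surj W p hX.2.2.2 hns ⟨(primesEquiv v : ℕ), inferInstance, hv,
      (W.hasMultiplicativeReductionAtPrime_iff_hasMultiplicativeReductionAt_ringOfIntegers v).mpr hm,
      hnd⟩

/-- **Every split multiplicative place of a corner pair forces `p ∣ Tam(E)` (`t ≥ 1`)** — at `p`
(`c_p = ord_p Δ_min`, divisible by `p`) or at `ℓ ≠ p` (`c_ℓ = ord_ℓ Δ_min`, divisible by `p` by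
`¬ Ram`); any prime `p`. [cite: SilvermanATAEC1994, Cor. IV.9.2 (d)] [cite: Jetchev2008, §1] -/
theorem NonSurjCorner.dvd_tamagawaProduct_of_split (hX : ClassX11b W p) (hns : ¬ Surj W p)
    {v : HeightOneSpectrum (𝓞 ℚ)} (hs : W.HasSplitMultiplicativeReductionAt v) :
    p ∣ W.tamagawaProduct :=
  dvd_tamagawaProduct_of_split_of_dvd W p hs
    (NonSurjCorner.dvd_ordMinimalDiscriminant_of_hasMultiplicativeReductionAt W p hX hns
      hs.hasMultiplicativeReductionAt)

/-- The same in the prime-indexed currency of the route file (`HasSplitMultiplicativeReductionAtPrime`,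
as in `Theorems.NonSurjCornerTwinMuAn`): a corner pair which is split multiplicative at some prime `ℓ`
(possibly `ℓ = p`) has `p ∣ Tam(E)`. Bridge: the tree's
`hasSplitMultiplicativeReductionAtPrime_iff_hasSplitMultiplicativeReductionAt`.
[cite: SilvermanATAEC1994, Cor. IV.9.2 (d)] -/
theorem NonSurjCorner.dvd_tamagawaProduct_of_hasSplitMultiplicativeReductionAtPrime (hX : ClassX11b W p)
    (hns : ¬ Surj W p) {ℓ : ℕ} [hℓ : Fact ℓ.Prime] (hs : W.HasSplitMultiplicativeReductionAtPrime ℓ) :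
    p ∣ W.tamagawaProduct := by
  set v : HeightOneSpectrum (𝓞 ℚ) := (primesEquiv (R := 𝓞 ℚ)).symm ⟨ℓ, hℓ.out⟩ with hvdef
  have hv : primesEquiv v = ⟨ℓ, hℓ.out⟩ := Equiv.apply_symm_apply _ _
  have key : ∀ q : Nat.Primes, primesEquiv v = q →
      (haveI := Fact.mk q.2; W.HasSplitMultiplicativeReductionAtPrime (q : ℕ)) →
        W.HasSplitMultiplicativeReductionAt v := by
    rintro q rfl h
    exact (hasSplitMultiplicativeReductionAtPrime_iff_hasSplitMultiplicativeReductionAt W v).mp h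
  exact NonSurjCorner.dvd_tamagawaProduct_of_split W p hX hns (key ⟨ℓ, hℓ.out⟩ hv hs)

/-- **On the corner, for `p ≥ 5`: `p ∣ Tam(E) ⟺ E has a split multiplicative place`** (`t ≥ 1 ⟺`
some `a_ℓ = +1` at a bad multiplicative `ℓ`, including `ℓ = p`). [cite: SilvermanATAEC1994, Cor. IV.9.2 (d) and Table 4.1]
[cite: Jetchev2008, §1] -/
theorem NonSurjCorner.dvd_tamagawaProduct_iff_exists_split (hX : ClassX11b W p) (hns : ¬ Surj W p)
    (hp5 : 5 ≤ p) :
    p ∣ W.tamagawaProduct ↔ ∃ v : HeightOneSpectrum (𝓞 ℚ), W.HasSplitMultiplicativeReductionAt v := by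
  rw [CornerLocal.dvd_tamagawaProduct_iff_exists_split W p hp5]
  exact ⟨fun ⟨v, hs, _⟩ => ⟨v, hs⟩, fun ⟨v, hs⟩ => ⟨v, hs,
    NonSurjCorner.dvd_ordMinimalDiscriminant_of_hasMultiplicativeReductionAt W p hX hns
      hs.hasMultiplicativeReductionAt⟩⟩

/-- **On the corner, for `p ≥ 5`: `t = 0` (`p ∤ Tam(E)`) ⟺ EVERY multiplicative place of `E` is
non-split** — the `t = 0` sub-corner of lane A's `…KolyJTamZero` ∕ `…TwinLeafSub` is exactly the set of
corner pairs without a split multiplicative prime. [cite: SilvermanATAEC1994, Cor. IV.9.2 (d) and Table 4.1] -/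
theorem NonSurjCorner.not_dvd_tamagawaProduct_iff_forall_not_split (hX : ClassX11b W p)
    (hns : ¬ Surj W p) (hp5 : 5 ≤ p) :
    ¬ p ∣ W.tamagawaProduct ↔
      ∀ v : HeightOneSpectrum (𝓞 ℚ), ¬ W.HasSplitMultiplicativeReductionAt v := by
  rw [NonSurjCorner.dvd_tamagawaProduct_iff_exists_split W p hX hns hp5]
  push Not
  rfl

/-- **`t ≥ #{split multiplicative places}` on the corner** (`p ≥ 5`): in the sum
`t = Σ_{v split} ord_p ord_v(Δ_min)` every term is `≥ 1`. [cite: SilvermanATAEC1994, Cor. IV.9.2 (d) and Table 4.1]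
[cite: Jetchev2008, §1] -/
theorem NonSurjCorner.card_filter_split_le_padicValNat_tamagawaProduct (hX : ClassX11b W p)
    (hns : ¬ Surj W p) (hp5 : 5 ≤ p) (S : Finset (HeightOneSpectrum (𝓞 ℚ))) :
    (S.filter fun v => W.HasSplitMultiplicativeReductionAt v).card ≤
      padicValNat p W.tamagawaProduct := by
  obtain ⟨T, hT⟩ := exists_finset_bad W
  -- enlarge to a finite set containing the bad places
  have hST : ∀ v, W.ordMinimalDiscriminant v ≠ 0 → v ∈ S ∪ T :=
    fun v hv => Finset.mem_union_right S ((hT v).mp hv)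
  rw [padicValNat_tamagawaProduct_eq_sum W p hp5 (S ∪ T) hST, Finset.card_eq_sum_ones,
    Finset.sum_filter]
  refine (Finset.sum_le_sum_of_subset_of_nonneg (Finset.subset_union_left) fun _ _ _ =>
    Nat.zero_le _).trans (Finset.sum_le_sum fun v _ => ?_)
  split_ifs with hs
  · have h0 : W.ordMinimalDiscriminant v ≠ 0 :=
      ordMinimalDiscriminant_ne_zero_of_hasMultiplicativeReductionAt v W hs.hasMultiplicativeReductionAt
    rw [← padicValNat_dvd_iff_le h0, pow_one]
    exact NonSurjCorner.dvd_ordMinimalDiscriminant_of_hasMultiplicativeReductionAt W p hX hns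
      hs.hasMultiplicativeReductionAt
  · exact le_rfl

/-- **The `t = 0` sub-corner is NON-SPLIT at `p`** (and at every other multiplicative prime): for a
corner pair with `p ∤ Tam(E)`, no place is split multiplicative (any prime `p`; contrapositive of
`NonSurjCorner.dvd_tamagawaProduct_of_split`). [cite: SilvermanATAEC1994, Cor. IV.9.2 (d)] -/
theorem NonSurjCorner.not_split_of_not_dvd_tamagawaProduct (hX : ClassX11b W p) (hns : ¬ Surj W p)
    (ht : ¬ p ∣ W.tamagawaProduct) (v : HeightOneSpectrum (𝓞 ℚ)) :
    ¬ W.HasSplitMultiplicativeReductionAt v :=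
  fun hs => ht (NonSurjCorner.dvd_tamagawaProduct_of_split W p hX hns hs)

/-- Prime-indexed form: on the `t = 0` sub-corner `E` is not split multiplicative at any prime `ℓ`, in
particular `¬ W.HasSplitMultiplicativeReductionAtPrime p` (`a_p = −1`).
[cite: SilvermanATAEC1994, Cor. IV.9.2 (d)] -/
theorem NonSurjCorner.not_hasSplitMultiplicativeReductionAtPrime_of_not_dvd_tamagawaProduct
    (hX : ClassX11b W p) (hns : ¬ Surj W p) (ht : ¬ p ∣ W.tamagawaProduct) (ℓ : ℕ) [Fact ℓ.Prime] :
    ¬ W.HasSplitMultiplicativeReductionAtPrime ℓ :=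
  fun hs => ht (NonSurjCorner.dvd_tamagawaProduct_of_hasSplitMultiplicativeReductionAtPrime W p hX hns hs)

/-- **On the `t = 0` sub-corner `E(ℚ_p)[p] = 0`.** For a corner pair with `p ∤ Tam(E)`, `v` the place of
`p` and `ι : ℚ̄ → ℚ̄_v`: every `x ∈ E[p](ℚ̄)` fixed by the whole local Galois group `Γ_{ℚ_v}` (through
`res_ι`) is `0`. Composition of `NonSurjCorner.not_split_of_not_dvd_tamagawaProduct` with this seat's
`NonSurjCorner.forall_fixed_eq_zero_of_not_split` (non-split ⇒ `Γ_{ℚ_p}` acts on the inertia-fixed line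
by the non-trivial unramified quadratic character `χ_γ`, file `…LocalCharacter`).
[cite: SilvermanATAEC1994, Thm. V.5.3, Cor. IV.9.2 (d)] [cite: Serre1972, §1.12] -/
theorem NonSurjCorner.forall_fixed_eq_zero_of_not_dvd_tamagawaProduct (hX : ClassX11b W p)
    (hns : ¬ Surj W p) (ht : ¬ p ∣ W.tamagawaProduct)
    {v : HeightOneSpectrum (𝓞 ℚ)} (hv : (primesEquiv v : ℕ) = p)
    (ι : AlgebraicClosure ℚ →ₐ[ℚ] AlgebraicClosure (v.adicCompletion ℚ))
    (x : geomTorsion W p)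
    (hx : ∀ σ : absoluteGaloisGroup (v.adicCompletion ℚ), resGalOfEmb ι σ • x = x) : x = 0 :=
  NonSurjCorner.forall_fixed_eq_zero_of_not_split W p hX hns hv
    (NonSurjCorner.not_split_of_not_dvd_tamagawaProduct W p hX hns ht v) ι x hx

/-- **Conversely, a corner pair with a `ℚ_p`-rational point of order `p` has `t ≥ 1`**: a non-zero
`Γ_{ℚ_v}`-fixed `x ∈ E[p](ℚ̄)` forces split multiplicative reduction at `p`
(`NonSurjCorner.exists_fixed_torsion_iff_split`, file `…LocalCharacter`), hence `p ∣ c_p ∣ Tam(E)`.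
[cite: SilvermanATAEC1994, Thm. V.5.3, Cor. IV.9.2 (d)] -/
theorem NonSurjCorner.dvd_tamagawaProduct_of_fixed_ne_zero (hX : ClassX11b W p) (hns : ¬ Surj W p)
    {v : HeightOneSpectrum (𝓞 ℚ)} (hv : (primesEquiv v : ℕ) = p)
    (ι : AlgebraicClosure ℚ →ₐ[ℚ] AlgebraicClosure (v.adicCompletion ℚ))
    {x : geomTorsion W p} (hx0 : x ≠ 0)
    (hx : ∀ σ : absoluteGaloisGroup (v.adicCompletion ℚ), resGalOfEmb ι σ • x = x) :
    p ∣ W.tamagawaProduct :=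
  NonSurjCorner.dvd_tamagawaProduct_of_split W p hX hns
    ((NonSurjCorner.exists_fixed_torsion_iff_split W p hX hns hv ι).mp ⟨x, hx0, hx⟩)

end Corner

end Summit.BirchSwinnertonDyer.BirchSwinnertonDyer.Theorems.CornerLocal

end
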